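import Literature.AlgebraicTopology.Homotopy.GridExtension
import Mathlib.Topology.MetricSpace.Thickening
import Mathlib.Topology.OpenPartialHomeomorph.Constructions
import HarnessLib

/-!
# Weakly contractible manifolds are contractible, I: the chart step

Topic `Literature/AlgebraicTopology/Homotopy`; first half of the proof of
`Literature.AlgebraicTopology.Homotopy.Manifold.contractibleSpace_of_subsingleton_homotopyGroup`
(`WeaklyContractibleManifold.lean`): a null-homotopy of the identity of a manifold all of whose
homotopy groups vanish is built chart by chart, and this file proves **the chart step**
(`Manifold.WeakContraction.nonempty_stepResult`).

Given a partial null-homotopy `H₀` of the identity (continuous on `W₀ × [0, 1]`, `W₀` open,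
`H₀(x, 0) = x`, `H₀(x, t) = x₀` for `t ≥ τ`), a compact `S ⊆ W₀` to be preserved, a chart `e`
(an `OpenPartialHomeomorph` into `ℝⁿ = Fin n → ℝ`, sup norm) and a compact `C ⊆ e.source` to be
absorbed, there is a partial null-homotopy on an open `W ⊇ S ∪ C`, constant from time `τ' > τ`
on, and equal to `H₀` on an open `V ⊇ S` (`Manifold.WeakContraction.StepResult`). Construction:
choose a side `ℓ > 0` below the Lebesgue numbers of `e(C) ⊆ e.target` and of (the part seen in
the chart of) `S` inside `e(W₀)`; in the rescaled coordinates `y ↦ ℓ • y` take the unit cubes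
meeting the `ε`-neighbourhood of `e(C)` (finitely many; their union `R` contains `ℓ⁻¹ e(C)` in
its interior and lies in the chart target); keep `H₀` on the cubes inside `ℓ⁻¹ e(W₀)` and refill
every other cell by the grid extension `Cubical.GridData.ext` of `GridExtension.lean`
(induction on the dimension of cells; boxes filled by `WhiteheadCW.exists_box_extension`,
Hatcher, *Algebraic Topology* (2002), Lemma 4.7); the new homotopy is the grid extension over
`e⁻¹(ℓ R)` and `H₀` elsewhere. Every cube meeting the image of `S` lies inside `ℓ⁻¹ e(W₀)` by
the choice of `ℓ`, so the new homotopy equals `H₀` on the open set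
`W₀ ∖ e.symm(ℓ ⋃ bad cubes) ⊇ S`, and it is continuous on the union of that open set with
`e⁻¹(ℓ interior R)` (`continuousOn_union_prod`).

Everything is proved (`[folklore]`); no named facts.

## References

* A. Hatcher, *Algebraic Topology*, CUP (2002), §4.1, Lemma 4.7. [HatcherAT2002]
-/

noncomputable section

open Set Metric

namespace Literature.AlgebraicTopology.Homotopy

namespace Manifold

universe u

namespace WeakContraction

open Cubical Cubical.Cell

variable {M : Type u} [TopologicalSpace M]

/-- Continuity on `(⋃ᵢ Uᵢ) × s` from continuity on each `Uᵢ × s`, `Uᵢ` open. [folklore] -/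
theorem continuousOn_iUnion_prod {ι : Sort*} {Y Z : Type*} [TopologicalSpace Y]
    [TopologicalSpace Z] {U : ι → Set M} (hU : ∀ i, IsOpen (U i)) {s : Set Y} {f : M × Y → Z}
    (hf : ∀ i, ContinuousOn f (U i ×ˢ s)) : ContinuousOn f ((⋃ i, U i) ×ˢ s) := by
  rintro ⟨x, y⟩ ⟨hx, hy⟩
  obtain ⟨i, hi⟩ := mem_iUnion.1 hx
  have h1 : ContinuousWithinAt f (U i ×ˢ s) (x, y) := hf i (x, y) ⟨hi, hy⟩
  refine h1.mono_of_mem_nhdsWithin ?_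
  refine mem_nhdsWithin.2 ⟨U i ×ˢ univ, (hU i).prod isOpen_univ, ⟨hi, mem_univ _⟩, ?_⟩
  rintro ⟨x', y'⟩ ⟨⟨hx', -⟩, ⟨-, hy'⟩⟩
  exact ⟨hx', hy'⟩

/-- Continuity on `(U₁ ∪ U₂) × s` from continuity on `U₁ × s` and `U₂ × s`, `Uᵢ` open.
[folklore] -/
theorem continuousOn_union_prod {Y Z : Type*} [TopologicalSpace Y] [TopologicalSpace Z]
    {U₁ U₂ : Set M} (h₁ : IsOpen U₁) (h₂ : IsOpen U₂) {s : Set Y} {f : M × Y → Z}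
    (hf₁ : ContinuousOn f (U₁ ×ˢ s)) (hf₂ : ContinuousOn f (U₂ ×ˢ s)) :
    ContinuousOn f ((U₁ ∪ U₂) ×ˢ s) := by
  rw [union_eq_iUnion]
  exact continuousOn_iUnion_prod (fun b => by cases b <;> assumption) fun b => by
    cases b <;> assumption

variable [T2Space M] {n : ℕ}

/-- The outcome of one chart step: a new partial null-homotopy `H` of the identity on the open
set `W`, constant `= x₀` from time `τ'` on, agreeing with the previous one `H₀` on the open set
`V ⊇ S`, with `S ∪ C ⊆ W`. [folklore] -/
structure StepResult (x₀ : M) (H₀ : M × ℝ → M) (S C : Set M) (τ' : ℝ) where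
  /-- the new domain -/
  W : Set M
  /-- the new homotopy -/
  H : M × ℝ → M
  /-- where the new homotopy agrees with the old one -/
  V : Set M
  isOpen_W : IsOpen W
  subset_W : S ∪ C ⊆ W
  cont : ContinuousOn H (W ×ˢ Icc (0 : ℝ) 1)
  zero : ∀ x ∈ W, H (x, 0) = x
  late : ∀ x ∈ W, ∀ t ∈ Icc τ' 1, H (x, t) = x₀
  isOpen_V : IsOpen V
  subset_V : S ⊆ V
  V_subset : V ⊆ W
  eqOn_V : ∀ x ∈ V, ∀ t, H (x, t) = H₀ (x, t)

/-- **One chart step** (see the module docstring). [folklore] -/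
theorem nonempty_stepResult {x₀ : M} (hX : WhiteheadCW.CubesContract x₀)
    (e : OpenPartialHomeomorph M (Fin n → ℝ)) {C : Set M} (hC : IsCompact C) (hCe : C ⊆ e.source)
    {W₀ : Set M} (hW₀ : IsOpen W₀) {S : Set M} (hS : IsCompact S) (hSW : S ⊆ W₀)
    {H₀ : M × ℝ → M} (hH₀ : ContinuousOn H₀ (W₀ ×ˢ Icc (0 : ℝ) 1)) (h0 : ∀ x ∈ W₀, H₀ (x, 0) = x)
    {τ τ' : ℝ} (hτ : 0 < τ) (hττ' : τ < τ') (hτ'1 : τ' ≤ 1)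
    (hlate : ∀ x ∈ W₀, ∀ t ∈ Icc τ 1, H₀ (x, t) = x₀) :
    Nonempty (StepResult x₀ H₀ S C τ') := by
  classical
  -- the compact `C' = e(C)` in the chart target and a compact neighbourhood `T` of it there
  set C' : Set (Fin n → ℝ) := e '' C with hC'def
  have hC' : IsCompact C' := hC.image_of_continuousOn (e.continuousOn.mono hCe)
  have hC't : C' ⊆ e.target := by rintro _ ⟨x, hx, rfl⟩; exact e.map_source (hCe hx)
  obtain ⟨δ₁, hδ₁, hδ₁t⟩ := hC'.exists_cthickening_subset_open e.open_target hC't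
  set ε : ℝ := δ₁ / 2 with hεdef
  have hε : 0 < ε := by positivity
  set T : Set (Fin n → ℝ) := cthickening δ₁ C' with hTdef
  have hT : IsCompact T := hC'.cthickening
  have hTt : T ⊆ e.target := hδ₁t
  -- the old homotopy in coordinates lives on the open set `De`
  set De : Set (Fin n → ℝ) := e.target ∩ e.symm ⁻¹' W₀ with hDedef
  have hDe : IsOpen De := e.continuousOn_symm.isOpen_inter_preimage e.open_target hW₀
  -- the part of `S` seen in `T`, a compact subset of `De`, and its Lebesgue number `δ₂`
  set SE : Set (Fin n → ℝ) := T ∩ e.symm ⁻¹' S with hSEdef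
  have hSEc : IsClosed SE :=
    (e.continuousOn_symm.mono hTt).preimage_isClosed_of_isClosed hT.isClosed hS.isClosed
  have hSE : IsCompact SE := hT.of_isClosed_subset hSEc inter_subset_left
  have hSED : SE ⊆ De := fun y hy => ⟨hTt hy.1, hSW hy.2⟩
  obtain ⟨δ₂, hδ₂, hδ₂D⟩ := hSE.exists_cthickening_subset_open hDe hSED
  -- the side of the grid, and the rescaling `s y = ℓ • y` (unit cubes ↦ cubes of side `ℓ`)
  set ℓ : ℝ := min ε δ₂ with hℓdef
  have hℓ : 0 < ℓ := lt_min hε hδ₂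
  have hℓε : ℓ ≤ ε := min_le_left _ _
  have hℓδ : ℓ ≤ δ₂ := min_le_right _ _
  set s : (Fin n → ℝ) → (Fin n → ℝ) := fun y => ℓ • y with hsdef
  have hsc : Continuous s := continuous_const_smul ℓ
  have hdist : ∀ y y' : Fin n → ℝ, dist (s y) (s y') = ℓ * dist y y' := fun y y' => by
    simp only [hsdef, dist_smul₀, Real.norm_eq_abs, abs_of_pos hℓ]
  have hs_inv : ∀ x : M, s (ℓ⁻¹ • e x) = e x := fun x => by
    simp only [hsdef, smul_inv_smul₀ hℓ.ne']
  -- the grid data, in the rescaled coordinates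
  set U : Set (Fin n → ℝ) := s ⁻¹' e.target with hUdef
  set D : Set (Fin n → ℝ) := s ⁻¹' De with hDdef
  have hg : ContinuousOn (fun p : (Fin n → ℝ) × ℝ => (e.symm (s p.1), p.2)) (D ×ˢ Icc (0 : ℝ) 1) :=
    ((e.continuousOn_symm.comp (hsc.comp continuous_fst).continuousOn
      fun p hp => hp.1.1)).prodMk continuousOn_snd
  let gd : GridData M n :=
    { x₀ := x₀, hX := hX, tau := τ, tau' := τ', tau_pos := hτ, tau_lt_tau' := hττ',
      tau'_le_one := hτ'1,
      U := U, bottom := fun y => e.symm (s y),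
      bottom_cont := e.continuousOn_symm.comp hsc.continuousOn fun y hy => hy,
      D := D, hDU := fun y hy => hy.1,
      old := fun p => H₀ (e.symm (s p.1), p.2),
      old_cont := hH₀.comp hg fun p hp => ⟨hp.1.2, hp.2⟩,
      old_zero := fun y hy => h0 _ hy.2,
      old_late := fun y hy t ht => hlate _ hy.2 t ht }
  -- the cubes of the step: unit cubes whose rescaling meets the `ε`-neighbourhood of `C'`
  set P : Set (Fin n → ℤ) := {m | (cube m ∩ s ⁻¹' cthickening ε C').Nonempty} with hPdef
  have hPfin : P.Finite := by
    refine finite_setOf_cube_inter_nonempty ?_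
    have hb : Bornology.IsBounded (cthickening ε C') := (hC'.cthickening (r := ε)).isBounded
    obtain ⟨ρ, hρ⟩ := hb.subset_closedBall 0
    refine (isBounded_closedBall (x := (0 : Fin n → ℝ)) (r := ρ / ℓ)).subset fun y hy => ?_
    have h1 : ‖s y‖ ≤ ρ := mem_closedBall_zero_iff.1 (hρ hy)
    rw [mem_closedBall_zero_iff, le_div_iff₀ hℓ]
    simpa only [hsdef, norm_smul, Real.norm_eq_abs, abs_of_pos hℓ, mul_comm] using h1
  have hPT : ∀ m ∈ P, ∀ y ∈ cube m, s y ∈ T := by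
    rintro m ⟨y, hym, hyC⟩ y' hy'
    have h1 : s y' ∈ cthickening ε (cthickening ε C') := by
      refine mem_cthickening_of_dist_le (s y') (s y) ε _ hyC ?_
      rw [hdist]
      calc ℓ * dist y' y ≤ ℓ * 1 := by gcongr; exact dist_le_one_of_mem_ccl hy' hym
        _ ≤ ε := by linarith
    have h2 := cthickening_cthickening_subset hε.le hε.le C' h1
    rw [hTdef, show δ₁ = ε + ε by rw [hεdef]; ring]
    exact h2
  have hPU : ∀ m ∈ P, cube m ⊆ U := fun m hm y hy => hTt (hPT m hm y hy)
  set R : Set (Fin n → ℝ) := ⋃ m ∈ P, cube m with hRdef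
  have hCR : ∀ x ∈ C, ℓ⁻¹ • e x ∈ interior R := by
    intro x hx
    refine mem_interior.2 ⟨ball (ℓ⁻¹ • e x) 1, fun y' hy' => ?_, isOpen_ball, mem_ball_self one_pos⟩
    have h1 : s y' ∈ cthickening ε C' := by
      refine mem_cthickening_of_dist_le (s y') (e x) ε C' ⟨x, hx, rfl⟩ ?_
      rw [← hs_inv x, hdist]
      calc ℓ * dist y' (ℓ⁻¹ • e x) ≤ ℓ * 1 := by gcongr; exact (mem_ball.1 hy').le
        _ ≤ ε := by linarith
    exact mem_iUnion₂.2 ⟨_, ⟨y', mem_cube_floor y', h1⟩, mem_cube_floor y'⟩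
  -- the bad cubes (not inside `D`) and their shadow `Z` in `M`
  set B : Set (Fin n → ℝ) := ⋃ m ∈ {m ∈ P | ¬ cube m ⊆ D}, cube m with hBdef
  have hB : IsCompact B :=
    (hPfin.subset (sep_subset _ _)).isCompact_biUnion fun m _ => isCompact_ccl _
  have hBt : ∀ y ∈ B, s y ∈ e.target := fun y hy => by
    obtain ⟨m, hm, hym⟩ := mem_iUnion₂.1 hy
    exact hPU m hm.1 hym
  set Z : Set M := (fun y => e.symm (s y)) '' B with hZdef
  have hZ : IsCompact Z :=
    hB.image_of_continuousOn (e.continuousOn_symm.comp hsc.continuousOn fun y hy => hBt y hy)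
  set V : Set M := W₀ \ Z with hVdef
  have hV : IsOpen V := hW₀.sdiff hZ.isClosed
  -- `S ⊆ V`: a cube meeting the image of `S` lies within `δ₂` of `SE`, hence inside `D`
  have hcubeD : ∀ m ∈ P, ∀ y ∈ cube m, e.symm (s y) ∈ S → cube m ⊆ D := by
    intro m hm y hy hyS y' hy'
    have hySE : s y ∈ SE := ⟨hPT m hm y hy, hyS⟩
    refine hδ₂D (mem_cthickening_of_dist_le (s y') (s y) δ₂ SE hySE ?_)
    rw [hdist]
    calc ℓ * dist y' y ≤ ℓ * 1 := by gcongr; exact dist_le_one_of_mem_ccl hy' hy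
      _ ≤ δ₂ := by linarith
  have hSV : S ⊆ V := by
    refine fun x hx => ⟨hSW hx, ?_⟩
    rintro ⟨y, hyB, rfl⟩
    obtain ⟨m, ⟨hmP, hmD⟩, hym⟩ := mem_iUnion₂.1 hyB
    exact hmD (hcubeD m hmP y hym hx)
  -- the new homotopy and its domain
  set ch : M → (Fin n → ℝ) := fun x => ℓ⁻¹ • e x with hchdef
  have hch : ContinuousOn ch e.source := (continuous_const_smul ℓ⁻¹).comp_continuousOn e.continuousOn
  set H : M × ℝ → M := fun p => if p.1 ∈ e.source ∧ ch p.1 ∈ R then gd.ext (ch p.1, p.2) else H₀ p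
    with hHdef
  set O : Set M := e.source ∩ ch ⁻¹' interior R with hOdef
  have hO : IsOpen O := hch.isOpen_inter_preimage e.open_source isOpen_interior
  -- on `V` the new homotopy is the old one
  have hHV : ∀ x ∈ V, ∀ t, H (x, t) = H₀ (x, t) := by
    intro x hx t
    simp only [hHdef]
    split_ifs with hc
    · obtain ⟨m, hmP, hym⟩ := mem_iUnion₂.1 hc.2
      have hxe : e.symm (s (ch x)) = x := by rw [hchdef, hs_inv x, e.left_inv hc.1]
      have hmD : cube m ⊆ D := by
        by_contra hcon
        exact hx.2 ⟨ch x, mem_iUnion₂.2 ⟨m, ⟨hmP, hcon⟩, hym⟩, hxe⟩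
      rw [gd.ext_of_kept hmD hym t]
      show H₀ (e.symm (s (ch x)), t) = H₀ (x, t)
      rw [hxe]
    · rfl
  -- on `O` the new homotopy is the grid extension
  have hHO : ∀ p ∈ O ×ˢ Icc (0 : ℝ) 1, H p = gd.ext (ch p.1, p.2) := by
    rintro ⟨x, t⟩ ⟨⟨hx, hxR⟩, -⟩
    simp only [hHdef]
    rw [if_pos ⟨hx, interior_subset hxR⟩]
  have hextR : ContinuousOn gd.ext (R ×ˢ Icc (0 : ℝ) 1) := by
    haveI : Finite ↥P := hPfin.to_subtype
    rw [hRdef, biUnion_eq_iUnion, iUnion_prod_const]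
    exact (locallyFinite_of_finite _).continuousOn_iUnion
      (fun m => (isClosed_ccl _).prod isClosed_Icc) fun m => gd.ext_continuousOn (hPU m.1 m.2)
  have hHcontO : ContinuousOn H (O ×ˢ Icc (0 : ℝ) 1) := by
    refine ContinuousOn.congr ?_ hHO
    refine hextR.comp ((hch.mono inter_subset_left).comp continuousOn_fst
      (fun p hp => hp.1) |>.prodMk continuousOn_snd) ?_
    rintro ⟨x, t⟩ ⟨⟨-, hxR⟩, ht⟩
    exact ⟨interior_subset hxR, ht⟩
  have hHcontV : ContinuousOn H (V ×ˢ Icc (0 : ℝ) 1) :=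
    (hH₀.mono (prod_mono sdiff_subset Subset.rfl)).congr fun p hp => hHV p.1 hp.1 p.2
  -- every point of `R` lies in a cube of the step, inside `U`
  have hcell : ∀ y ∈ R, ∃ m ∈ P, y ∈ cube m ∧ cube m ⊆ U := fun y hy => by
    obtain ⟨m, hmP, hym⟩ := mem_iUnion₂.1 hy
    exact ⟨m, hmP, hym, hPU m hmP⟩
  refine ⟨{
    W := O ∪ V
    H := H
    V := V
    isOpen_W := hO.union hV
    subset_W := ?_
    cont := continuousOn_union_prod hO hV hHcontO hHcontV
    zero := ?_
    late := ?_
    isOpen_V := hV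
    subset_V := hSV
    V_subset := subset_union_right
    eqOn_V := hHV }⟩
  · rintro x (hx | hx)
    · exact Or.inr (hSV hx)
    · exact Or.inl ⟨hCe hx, hCR x hx⟩
  · intro x hx
    by_cases hc : x ∈ e.source ∧ ch x ∈ R
    · obtain ⟨m, -, hym, hmU⟩ := hcell _ hc.2
      simp only [hHdef]
      rw [if_pos hc, gd.ext_zero hmU hym]
      show e.symm (s (ch x)) = x
      rw [hchdef, hs_inv x, e.left_inv hc.1]
    · have hxV : x ∈ V := by
        rcases hx with hx | hx
        · exact absurd ⟨hx.1, interior_subset hx.2⟩ hc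
        · exact hx
      rw [hHV x hxV]; exact h0 x hxV.1
  · intro x hx t ht
    by_cases hc : x ∈ e.source ∧ ch x ∈ R
    · obtain ⟨m, -, hym, hmU⟩ := hcell _ hc.2
      simp only [hHdef]
      rw [if_pos hc]
      exact gd.ext_late hmU hym ht
    · have hxV : x ∈ V := by
        rcases hx with hx | hx
        · exact absurd ⟨hx.1, interior_subset hx.2⟩ hc
        · exact hx
      rw [hHV x hxV]; exact hlate x hxV.1 t ⟨hττ'.le.trans ht.1, ht.2⟩

end WeakContraction

end Manifold

end Literature.AlgebraicTopology.Homotopy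

end
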